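import Literature.Probability.Percolation.InterfaceScalingLimitDiscretised
import Literature.Probability.LatticeModels.FKIsingInterfaceSource
import HarnessLib

/-!
# Subsequential limits of the bond-percolation interface laws are carried by curves from `a`

Route `CardyComplexCone` (sub-problem `CriticalPhenomena/CardyFormulaZ2`), crux
`Summit.CriticalPhenomena.CardyFormulaZ2.Theses.CardyComplexCone.ParafermionToSLESixFamilies`
(item stmt-CriticalPhenomena-11389), line `caratheodory-net-slit-uniformity`, stub
`stub_slitMartingaleData` (`IdentifiedLimit → CarrierEquicontinuity → UniformPrecompact →
SlitMartingaleData`). This file proves the registered glue sub-goal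
`ae_source_eq_of_tendsto_bondInterfaceIn`, i.e. the clause "`ν`-a.e. `c.source = D.pt 0`" of
`SlitMartingaleData`: for every Dobrushin domain `(D; a, b)`, every discretisation family
`Λ` (`ZdDiscretisationFamily D Λ`), meshes `u n → 0⁺` and every finite measure `ν` on the curve
space to which the laws of the bond interfaces `bondInterfaceIn D (Λ (u n))` under critical bond
percolation converge weakly, `ν`-a.e. curve class starts at `a = D.pt 0`.

It is the bond-percolation clone of the spin-Ising / FK-Ising lemmas
`LatticeModels.ae_source_eq_of_tendsto_spinInterfaceLaw` (`InterfaceSLESource.lean`) and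
`LatticeModels.ae_source_eq_of_tendsto_fkInterfaceCurve` (`FKIsingInterfaceSource.lean`), with
the orientation device `orientCurve D` of `bondInterfaceIn` (time reversal of the parametrised
polyline) in place of `orientChord D` (reversal of the vertex list):

* the medial exploration polygon of admissible data runs from the midpoint of one `A`–`B`
  boundary edge to the midpoint of the other, so the set of discrete marked points
  `medialPoint δ '' zdABEdges` is exactly `{first vertex, last vertex}` — the tree's
  `LatticeModels.IsMedialExploration.exists_cons_map_medialPoint` (`FKIsingInterfaceSource.lean`);
* `dist_source_mk_orientCurve_polyline_lt` — if the first vertex is within `ε` of `a` or of `b`,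
  one of the two end vertices is within `ε` of `a`, and `2ε ≤ |a - b|`, then the class of the
  re-oriented polyline starts within `ε` of `a`;
* `dist_source_bondInterfaceIn_lt` — hence the bond interface of admissible data whose discrete
  marked points are `ε`-close to `{a, b}` in Hausdorff distance starts within `ε` of `a`
  (`isMedialExploration_medialExploration_holds`);
* `ae_source_eq_of_tendsto_bondInterfaceIn` — the limit statement through the bounded continuous
  test function `c ↦ min 1 (dist c.source a)` (no portmanteau theorem needed).
-/

noncomputable section

open scoped Topology NNReal ENNReal BoundedContinuousFunction unitInterval
open Filter Set MeasureTheory Metric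
open Literature.Probability Literature.Probability.LatticeModels Literature.Probability.Percolation
open Literature.Probability.RandomPlanarGeometry

namespace Summit.CriticalPhenomena.CardyFormulaZ2.Cruxes.ParafermionToSLESixFamilies.CaratheodoryNetSlitUniformity

/-! ### Orientation: the re-oriented polyline starts near `a` -/

/-- The source of the class of the re-oriented curve `orientCurve D γ` is `γ 0` if `γ 0` is at
least as close to `a` as to `b`, and `γ 1` otherwise. -/
theorem source_mk_orientCurve (D : DobrushinDomain) (γ : C(I, ℂ)) :
    (CurveClass.mk (orientCurve D γ)).source =
      if dist (γ 0) (D.pt 0) ≤ dist (γ 0) (D.pt 1) then γ 0 else γ 1 := by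
  by_cases h : dist (γ 0) (D.pt 0) ≤ dist (γ 0) (D.pt 1)
  · rw [if_pos h, orientCurve_of_le D h, CurveClass.source_mk]
    rfl
  · rw [if_neg h, orientCurve_of_lt D (not_le.1 h), CurveClass.source_mk, Curve.source_def]
    show reverseCurve γ 0 = γ 1
    rw [reverseCurve_apply, unitInterval.symm_zero]

/-- **The re-oriented polyline starts within `ε` of `a`.** If the first and last vertices `z`,
`z'` of a nonempty vertex list satisfy: `z` is within `ε` of `a` or of `b`, and one of `z`, `z'`
is within `ε` of `a` (both hold when `{z, z'}` is within Hausdorff distance `ε` of `{a, b}`),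
and `2ε ≤ |a - b|`, then the curve class of the polyline re-oriented by the endpoint rule
`orientCurve D` (keep the curve if its starting point is at least as close to `a` as to `b`,
time-reverse it otherwise) starts within `ε` of `a = D.pt 0` (the `orientCurve` twin of
`LatticeModels.dist_source_mk_polyline_orientChord_lt`). -/
theorem dist_source_mk_orientCurve_polyline_lt (D : DobrushinDomain) {z : ℂ} {l : List ℂ}
    {ε : ℝ} (hε : 2 * ε ≤ dist (D.pt 0) (D.pt 1))
    (hz : dist z (D.pt 0) < ε ∨ dist z (D.pt 1) < ε)
    (ha : dist z (D.pt 0) < ε ∨ dist ((z :: l).getLast (List.cons_ne_nil z l)) (D.pt 0) < ε) :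
    dist (CurveClass.mk (orientCurve D (polyline (z :: l)))).source (D.pt 0) < ε := by
  rw [source_mk_orientCurve, polyline_apply_zero, polyline_apply_one]
  by_cases hle : dist z (D.pt 0) ≤ dist z (D.pt 1)
  · rw [if_pos hle]
    rcases hz with h | h
    · exact h
    · exact hle.trans_lt h
  · rw [if_neg hle]
    rcases ha with h | h
    · -- `z` is near `a` but closer to `b`: impossible when `2ε ≤ |a - b|`
      exfalso
      rw [not_le] at hle
      have := dist_triangle_left (D.pt 0) (D.pt 1) z
      linarith
    · exact h

/-- **The bond interface starts within `ε` of `a`** when the data are admissible and the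
discrete marked points are within Hausdorff distance `ε` (`2ε ≤ |a - b|`) of `{a, b}`:
`medialExploration E ω` is the genuine exploration path
(`isMedialExploration_medialExploration_holds`), by
`IsMedialExploration.exists_cons_map_medialPoint` the set of
discrete marked points is the set of end points of its polygon, and
`dist_source_mk_orientCurve_polyline_lt` applies to the re-orientation `orientCurve D` used by
`bondInterfaceIn`. -/
theorem dist_source_bondInterfaceIn_lt (D : DobrushinDomain) {E : DiscreteDobrushin}
    (hE : E.IsZdAdmissible) (ω : BondConfig (Site 2)) {ε : ℝ} (hε0 : 0 < ε)
    (hε : 2 * ε ≤ dist (D.pt 0) (D.pt 1))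
    (hH : hausdorffEDist (medialPoint E.δ '' E.zdABEdges) {D.pt 0, D.pt 1} < ENNReal.ofReal ε) :
    dist (bondInterfaceIn D E ω).source (D.pt 0) < ε := by
  have hγ : IsMedialExploration E ω (medialExploration E ω) :=
    isMedialExploration_medialExploration_holds E hE ω
  obtain ⟨z, l, hzl, hset⟩ := hγ.exists_cons_map_medialPoint hE E.δ
  rw [bondInterfaceIn_apply, medialExplorationCurve, hzl]
  -- translate the Hausdorff bound
  have hnear : ∀ p ∈ ({z, (z :: l).getLast (List.cons_ne_nil z l)} : Set ℂ),
      dist p (D.pt 0) < ε ∨ dist p (D.pt 1) < ε := by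
    intro p hp
    rw [← hset] at hp
    obtain ⟨q, hq, hpq⟩ := exists_edist_lt_of_hausdorffEDist_lt hp hH
    rw [edist_dist, ENNReal.ofReal_lt_ofReal_iff hε0] at hpq
    rcases hq with rfl | rfl
    · exact Or.inl hpq
    · exact Or.inr hpq
  have ha : dist z (D.pt 0) < ε ∨ dist ((z :: l).getLast (List.cons_ne_nil z l)) (D.pt 0) < ε := by
    have hH' : hausdorffEDist {D.pt 0, D.pt 1} (medialPoint E.δ '' E.zdABEdges) <
        ENNReal.ofReal ε := by
      rwa [hausdorffEDist_comm]
    obtain ⟨p, hp, hpq⟩ := exists_edist_lt_of_hausdorffEDist_lt (Set.mem_insert _ _) hH'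
    rw [edist_dist, ENNReal.ofReal_lt_ofReal_iff hε0, dist_comm] at hpq
    rw [hset] at hp
    rcases hp with rfl | rfl
    · exact Or.inl hpq
    · exact Or.inr hpq
  exact dist_source_mk_orientCurve_polyline_lt D hε (hnear z (Set.mem_insert _ _)) ha

/-! ### The limit statement -/

/-- **Weak limits of the bond-percolation interface laws along meshes `u n → 0⁺` are carried by
curves from `a`** (registered glue sub-goal of the skeleton of line
`caratheodory-net-slit-uniformity`; the clause "`∀ᵐ c ∂ν, c.source = D.pt 0`" of
`SlitMartingaleData`). Let `Λ` be a discretisation family of the Dobrushin domain `(D; a, b)`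
(`ZdDiscretisationFamily`), `u n → 0⁺` meshes and `ν` a finite measure on the curve space such
that `∫ f (bondInterfaceIn D (Λ (u n)) ω) dP_{1/2}(ω) → ∫ f dν` for every bounded continuous `f`.
Then `ν`-a.e. curve class starts at `a = D.pt 0`. Proof: the bounded continuous function
`g c = min 1 (dist c.source a) ≥ 0` has `∫ g (bondInterfaceIn …) dP_{1/2} ≤ ε` for all large `n`
(every interface of an admissible discretisation at a mesh where the discrete marked points are
`ε`-close to `{a, b}` starts within `ε` of `a`, `dist_source_bondInterfaceIn_lt`; the family is
eventually admissible with convergent marks, `ZdDiscretisationFamily.eventually_isZdAdmissible`,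
`tendsto_zdABEdges`, `δ_eq`), so `∫ g dν = 0`. -/
theorem ae_source_eq_of_tendsto_bondInterfaceIn : ∀ (D : DobrushinDomain) (Λ : ℝ → DiscreteDobrushin), ZdDiscretisationFamily D Λ → ∀ (u : ℕ → ℝ), Tendsto u atTop (𝓝[>] (0:ℝ)) → ∀ (ν : Measure (CurveClass ℂ)) [IsFiniteMeasure ν], (∀ f : CurveClass ℂ →ᵇ ℝ, Tendsto (fun n => ∫ ω, f (bondInterfaceIn D (Λ (u n)) ω) ∂(bondPercolation (zdGraph 2) half)) atTop (𝓝 (∫ x, f x ∂ν))) → ∀ᵐ c ∂ν, c.source = D.pt 0 := by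
  intro D Λ hΛ u hu ν _ hlim
  -- the test function
  set g : CurveClass ℂ →ᵇ ℝ := BoundedContinuousFunction.mkOfBound
    ⟨fun c ↦ min 1 (dist c.source (D.pt 0)),
      (continuous_const.min (CurveClass.continuous_source.dist continuous_const))⟩
    1 (fun c c' ↦ by
      simp only [ContinuousMap.coe_mk, Real.dist_eq]
      have h1 : 0 ≤ min 1 (dist c.source (D.pt 0)) := le_min zero_le_one dist_nonneg
      have h2 : 0 ≤ min 1 (dist c'.source (D.pt 0)) := le_min zero_le_one dist_nonneg
      have h3 : min 1 (dist c.source (D.pt 0)) ≤ 1 := min_le_left _ _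
      have h4 : min 1 (dist c'.source (D.pt 0)) ≤ 1 := min_le_left _ _
      rw [abs_le]; constructor <;> linarith) with hg
  have hg_apply : ∀ c, g c = min 1 (dist c.source (D.pt 0)) := fun c ↦ rfl
  have hg0 : ∀ c, 0 ≤ g c := fun c ↦ by rw [hg_apply]; exact le_min zero_le_one dist_nonneg
  -- `∫ g dν ≤ ε` for every small `ε > 0`
  have key : ∀ ε : ℝ, 0 < ε → 2 * ε ≤ dist (D.pt 0) (D.pt 1) → ∫ c, g c ∂ν ≤ ε := by
    intro ε hε hε2
    -- eventually (in the mesh) the lattice conditions hold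
    have hev : ∀ᶠ n in atTop, (Λ (u n)).IsZdAdmissible ∧
        hausdorffEDist (medialPoint (u n) '' (Λ (u n)).zdABEdges) {D.pt 0, D.pt 1} <
          ENNReal.ofReal ε := by
      have h2 := hΛ.eventually_isZdAdmissible
      have h3 : ∀ᶠ δ in 𝓝[>] (0 : ℝ),
          hausdorffEDist (medialPoint δ '' (Λ δ).zdABEdges) {D.pt 0, D.pt 1} < ENNReal.ofReal ε :=
        hΛ.tendsto_zdABEdges (Iio_mem_nhds (ENNReal.ofReal_pos.2 hε))
      exact hu.eventually (h2.and h3)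
    have hbound : ∀ᶠ n in atTop,
        ∫ ω, g (bondInterfaceIn D (Λ (u n)) ω) ∂(bondPercolation (zdGraph 2) half) ≤ ε := by
      filter_upwards [hev] with n hn
      obtain ⟨hadm, hH⟩ := hn
      have hH' : hausdorffEDist (medialPoint (Λ (u n)).δ '' (Λ (u n)).zdABEdges) {D.pt 0, D.pt 1} <
          ENNReal.ofReal ε := by
        rw [hΛ.δ_eq (u n)]
        exact hH
      -- every interface curve at this mesh starts within `ε` of `a`
      have hall : ∀ ω, g (bondInterfaceIn D (Λ (u n)) ω) ≤ ε := by
        intro ω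
        rw [hg_apply]
        exact (min_le_right _ _).trans (dist_source_bondInterfaceIn_lt D hadm ω hε hε2 hH').le
      calc ∫ ω, g (bondInterfaceIn D (Λ (u n)) ω) ∂(bondPercolation (zdGraph 2) half)
          ≤ ∫ _, ε ∂(bondPercolation (zdGraph 2) half) := by
            refine integral_mono_of_nonneg (ae_of_all _ fun ω ↦ hg0 _) (integrable_const ε)
              (ae_of_all _ fun ω ↦ hall ω)
        _ = ε := by simp
    exact le_of_tendsto (hlim g) hbound
  -- hence `∫ g dν ≤ 0`, so `g = 0` a.e.
  have hint0 : ∫ c, g c ∂ν = 0 := by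
    refine le_antisymm ?_ (integral_nonneg hg0)
    refine le_of_forall_pos_le_add fun ε hε ↦ ?_
    rw [zero_add]
    have hab : 0 < dist (D.pt 0) (D.pt 1) :=
      dist_pos.2 fun h ↦ absurd (D.pt_injective h) (by decide)
    set ε' : ℝ := min ε (dist (D.pt 0) (D.pt 1) / 2) with hε'
    have hε'0 : 0 < ε' := lt_min hε (by positivity)
    have hε'2 : 2 * ε' ≤ dist (D.pt 0) (D.pt 1) := by
      have := min_le_right ε (dist (D.pt 0) (D.pt 1) / 2)
      linarith
    exact (key ε' hε'0 hε'2).trans (min_le_left _ _)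
  have hgi : Integrable (fun c ↦ g c) ν := g.integrable ν
  have hae := (integral_eq_zero_iff_of_nonneg (fun c ↦ hg0 c) hgi).1 hint0
  filter_upwards [hae] with c hc
  have hc' : min 1 (dist c.source (D.pt 0)) = 0 := hc
  rcases min_eq_iff.1 hc' with ⟨h1, -⟩ | ⟨h2, -⟩
  · exact absurd h1 one_ne_zero
  · exact dist_eq_zero.1 h2

end Summit.CriticalPhenomena.CardyFormulaZ2.Cruxes.ParafermionToSLESixFamilies.CaratheodoryNetSlitUniformity

end
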